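import Literature.Analysis.InnerProduct.LensSpaceSpectrum
import Mathlib.Analysis.SpecialFunctions.Trigonometric.Chebyshev.Basic
import HarnessLib

/-!
# The spectrum of a three-dimensional lens space from the ONE-NORM of its congruence lattice (Lauret–Miatello–Rossetti):
# `N_𝓛(k) = #{(a,b) ∈ ℤ² : |a| + |b| = k, q ∣ ap₁ + bp₂}` satisfies `N_𝓛(k) = dim E_{k(k+2)} − dim E_{(k−2)k}`, i.e.
# `(1 − z²)F_L(z) = Θ_𝓛(z)` (Theorem 3.1, n = 2), and `L`, `L'` are isospectral iff `Θ_𝓛 = Θ_𝓛'` (Theorem 3.2)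

Layer `Literature/Analysis/InnerProduct`, namespace `Literature.Analysis.InnerProduct`; lane `lit-hodgefound` (Track 2 foundations
library), prover seat `lit-hodgefound-p06`, generation 43, self-proposed row g43-#6 — the sequel BY IMPORT of row g43-#2
(`LensSpaceMultiplicity.lean`: `lensMultiplicity q p₁ p₂ k = dim E_{k(k+2)}(L(q;p₁,p₂))`; `LensSpaceSpectrum.lean`: Ikeda–Yamamoto's
(3.10) `lensMultiplicity_eq_sum_threeSphereHarmonicCharacter`, the orthogonality `sum_range_cos_two_pi_mul_div`, the power series
`mk_threeSphereHarmonicCharacter` and `coeff_succ_one_sub_X_sq_mul_mk_U_eval`). THEOREMS ONLY (no definition, no instance, no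
notation, no named fact): the one-norm count `N_𝓛(k)` is written in the statements as the cardinality of the finite set
`{(a,b) ∈ [−k,k]² : |a| + |b| = k ∧ q ∣ ap₁ + bp₂}` (`Finset.Icc` box, filtered); `|a| + |b| = k` forces `(a,b) ∈ [−k,k]²`, so this IS
`#{μ ∈ 𝓛(q;p₁,p₂) : ‖μ‖₁ = k}`.

## Source, verbatim (held text `paper:arxiv-1904.01146`, pp. 6–7)

E. A. Lauret, R. J. Miatello, J. P. Rossetti, *Spectra of orbifolds with cyclic fundamental groups* (survey, 2019), §3, restating
[LMR-onenorm] = E. A. Lauret, R. J. Miatello, J. P. Rossetti, *Spectra of lens spaces from 1-norm spectra of congruence lattices*,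
IMRN 2016 (4) 1054–1089: "`∑_{l=0}^{q−1}ξ_q^{lk} = q` if `q` divides `k`, `0` otherwise. … Thus, it is natural to associate to a lens
orbifold `L(q; s₁, …, s_n)` the congruence lattice `𝓛(q; s₁, …, s_n) := {(a₁, …, a_n) ∈ ℤⁿ : a₁s₁ + ⋯ + a_ns_n ≡ 0 (mod q)}`, as in
[LMR-onenorm]. For `k` a non-negative integer, we denote by `N_𝓛(k)` the number of elements in `𝓛 := 𝓛(q; s₁, …, s_n)` with one-norm
equal to `k`, that is, `N_𝓛(k) = #{μ = (a₁, …, a_n) ∈ 𝓛 : ‖μ‖₁ = |a₁| + ⋯ + |a_n| = k}`. We define the one-norm theta function of `𝓛`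
by `Θ_𝓛(z) := ∑_{k≥0}N_𝓛(k)z^k`. Since `Θ_𝓛(z) = ∑_{μ ∈ 𝓛}z^{‖μ‖₁}`, we have thus proved **Theorem 3.1.** If `L` is a lens orbifold
and `𝓛` its associated congruence lattice, then we have that `F_L(z) = Θ_𝓛(z)/(1 − z²)^{n−1}`." (p0006); "**Theorem 3.2**
[LMR-onenorm]. Let `L` and `L'` be two lens spaces and let `𝓛` and `𝓛'` be their corresponding congruence lattices. Then, `L` and
`L'` are isospectral if and only if `𝓛` and `𝓛'` are `‖·‖₁`-isospectral (i.e. `Θ_𝓛(z) = Θ_𝓛'(z)`)." (p0007). Here `F_L(z) = ∑_k dim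
E_{k(k+2n−2)}z^k` is Ikeda–Yamamoto's generating function (§2 of the survey; row g43-#4), `n = 2`, `(s₁, s₂) = (p₁, p₂)`.

## The proof (the survey's "long computation"), as formalised

`N_𝓛(k) = ∑_{|a|+|b|=k}[q ∣ ap₁ + bp₂] = ∑_{|a|+|b|=k}(1/q)∑_{l<q}cos(2πl(ap₁ + bp₂)/q)` (orthogonality of the characters of
`ℤ/q`, real parts) `= (1/q)∑_l ∑_{|a|+|b|=k}cos(aφ₁ + bφ₂)`, `φᵢ = 2πlpᵢ/q`. The inner sum is computed over `a ∈ {0, ±1, …, ±k}`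
(§1): `∑_{|a|+|b|=k}cos(aφ₁ + bφ₂) = ∑_{i+j=k}c_i(φ₁)c_j(φ₂)` with `c₀ = 1`, `c_m = 2cos(mφ)` — the sine parts cancel under `b ↦ −b`,
`a ↦ −a` — and `c_m(φ) = [X^m]((1 − X²)∑_kU_k(cos φ)X^k)` (`U_m − U_{m−2} = 2T_m`, row g43-#2), so by `∑_kχ̃_kX^k = (1 − X²)(∑U_iX^i)
(∑U_jX^j)` the inner sum is `[X^k]((1 − X²)∑_jχ̃_jX^j) = χ̃_k − χ̃_{k−2}` at `(cos φ₁, cos φ₂)` (§2). Summing over `l` with (3.10):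
`N_𝓛(k) = dim E_{k(k+2)} − dim E_{(k−2)k}` (§3), i.e. `Θ_𝓛 = (1 − z²)F_L`.

## What is proved

* §1 (private): `sum_Icc_neg_eq` (`∑_{a=−k}^{k} = h(0) + ∑_{i=1}^{k}(h(i) + h(−i))`), `sum_Icc_ite_abs_eq` (the fibre of the one-norm
  sphere over `|a| = i`), `sum_Icc_sum_Icc_ite_cos_eq` (`∑_{|a|+|b|=k}cos(aφ₁+bφ₂) = ∑_{i+j=k}c_ic_j`).
* §2: `ite_eq_coeff_one_sub_X_sq_mul_mk_U`, `coeff_one_sub_X_sq_mul_mk_threeSphereHarmonicCharacter` (private),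
  **`sum_oneNormSphere_cos_eq`** (`∑_{|a|+|b|=k}cos(aφ₁+bφ₂) = χ̃_k − χ̃_{k−2}` at `(cos φ₁, cos φ₂)`).
* §3: **`card_oneNormSphere_congruenceLattice_add`** (THEOREM 3.1, `n = 2`, coefficientwise: `N_𝓛(k) + dim E_{(k−2)k} = dim
  E_{k(k+2)}`), **`lensMultiplicity_eq_sum_card_oneNormSphere_congruenceLattice`** (`dim E_{k(k+2)} = ∑_{r ≤ k/2}N_𝓛(k − 2r)`),
  **`one_sub_X_sq_mul_mk_lensMultiplicity`** (`(1 − X²)·∑dim E_k X^k = ∑N_𝓛(k)X^k` in `ℝ⟦X⟧`),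
  **`lensMultiplicity_eq_iff_card_oneNormSphere_congruenceLattice_eq`** (THEOREM 3.2, `n = 2`), `card_oneNormSphere_congruenceLattice_zero`
  (`N_𝓛(0) = 1`), `card_oneNormSphere_congruenceLattice_one` (`N_𝓛(1) = 0` for a lens space), `card_oneNormSphere_int_sq` (`q = 1`:
  `#{|a|+|b| = k} = 4k`, `= 1` for `k = 0`; the `S³` check `(k+1)² − (k−1)² = 4k`).

## References

* [LauretMiatelloRossetti2019] E. A. Lauret, R. J. Miatello, J. P. Rossetti, *Spectra of orbifolds with cyclic fundamental groups*
  (2019), §3, Theorems 3.1, 3.2.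
* [LauretMiatelloRossetti2015] E. A. Lauret, R. J. Miatello, J. P. Rossetti, *Spectra of lens spaces from 1-norm spectra of
  congruence lattices*, Int. Math. Res. Not. IMRN 2016, no. 4, 1054–1089 (the original of Theorems 3.1–3.2).
* [IkedaYamamoto1979] A. Ikeda, Y. Yamamoto, *On the spectra of 3-dimensional lens spaces*, Osaka J. Math. 16 (1979) 447–469,
  §3 (3.10) (the multiplicities as character sums).
-/

noncomputable section

open Finset Polynomial.Chebyshev PowerSeries

namespace Literature.Analysis.InnerProduct

open _root_.Real

/-! ### §1 Sums over `{−k, …, k} ⊂ ℤ` and over the one-norm sphere `{(a,b) ∈ ℤ² : |a| + |b| = k}` -/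

/-- `{−(k+1), …, k+1} = {−(k+1), k+1} ∪ {−k, …, k}`. [folklore] -/
private theorem Icc_neg_succ_eq_insert (k : ℕ) : Finset.Icc (-((k + 1 : ℕ) : ℤ)) ((k + 1 : ℕ) : ℤ) =
    insert (-((k + 1 : ℕ) : ℤ)) (insert ((k + 1 : ℕ) : ℤ) (Finset.Icc (-(k : ℤ)) k)) := by
  ext a
  simp only [Finset.mem_Icc, Finset.mem_insert]
  push_cast
  omega

/-- `∑_{a=−k}^{k} h(a) = h(0) + ∑_{i=1}^{k}(h(i) + h(−i))`. [folklore] -/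
private theorem sum_Icc_neg_eq (h : ℤ → ℝ) (k : ℕ) :
    ∑ a ∈ Finset.Icc (-(k : ℤ)) k, h a = h 0 + ∑ i ∈ range k, (h ((i + 1 : ℕ) : ℤ) + h (-((i + 1 : ℕ) : ℤ))) := by
  induction k with
  | zero => simp
  | succ k ih =>
    rw [Icc_neg_succ_eq_insert, Finset.sum_insert, Finset.sum_insert, ih, Finset.sum_range_succ]
    · ring
    · simp only [Finset.mem_Icc]
      push_cast
      omega
    · simp only [Finset.mem_insert, Finset.mem_Icc]
      push_cast
      omega

/-- The inner sum over the one-norm sphere: for `|a| = i ≤ k`, `∑_{b : |a| + |b| = k} G(b) = G(0)` if `i = k`, else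
`G(k−i) + G(−(k−i))`. [folklore] -/
private theorem sum_Icc_ite_abs_eq (G : ℤ → ℝ) {a : ℤ} {i k : ℕ} (ha : |a| = i) (hik : i ≤ k) :
    ∑ b ∈ Finset.Icc (-(k : ℤ)) k, (if |a| + |b| = k then G b else 0) =
      if i = k then G 0 else G ((k - i : ℕ) : ℤ) + G (-((k - i : ℕ) : ℤ)) := by
  rw [sum_Icc_neg_eq, ha]
  simp only [abs_zero, add_zero, Nat.cast_inj, abs_neg, Nat.abs_cast]
  rcases eq_or_lt_of_le hik with rfl | hlt
  · rw [if_pos rfl, if_pos rfl, Finset.sum_eq_zero fun j _ ↦ ?_, add_zero]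
    have hc : ¬ ((i : ℤ) + ((j + 1 : ℕ) : ℤ) = (i : ℤ)) := by push_cast; omega
    rw [if_neg hc, if_neg hc, add_zero]
  · rw [if_neg (by omega), if_neg (by omega), zero_add, Finset.sum_eq_single (k - i - 1)]
    · have hc : (i : ℤ) + ((k - i - 1 + 1 : ℕ) : ℤ) = (k : ℤ) := by push_cast; omega
      rw [if_pos hc, if_pos hc, show k - i - 1 + 1 = k - i by omega]
    · intro j _ hj
      have hc : ¬ ((i : ℤ) + ((j + 1 : ℕ) : ℤ) = (k : ℤ)) := by push_cast; omega
      rw [if_neg hc, if_neg hc, add_zero]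
    · intro h
      exact absurd (mem_range.mpr (by omega)) h

/-- **The character sum over the one-norm sphere**: `∑_{|a|+|b| = k} cos(aφ₁ + bφ₂) = ∑_{i+j=k} c_i(φ₁)c_j(φ₂)`, `c₀ = 1`,
`c_m = 2cos(mφ)` (`m ≥ 1`) — `c_m(φ) = ∑_{a ∈ ℤ, |a| = m} e^{iaφ}`. [cite: LauretMiatelloRossetti2019, §3 (proof of Theorem 3.1)] -/
private theorem sum_Icc_sum_Icc_ite_cos_eq (φ₁ φ₂ : ℝ) (k : ℕ) :
    ∑ a ∈ Finset.Icc (-(k : ℤ)) k, ∑ b ∈ Finset.Icc (-(k : ℤ)) k,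
        (if |a| + |b| = (k : ℤ) then Real.cos (a * φ₁ + b * φ₂) else 0) =
      ∑ i ∈ range (k + 1), (if i = 0 then (1 : ℝ) else 2 * Real.cos (i * φ₁)) *
        (if k - i = 0 then (1 : ℝ) else 2 * Real.cos ((k - i : ℕ) * φ₂)) := by
  rw [sum_Icc_neg_eq (fun a : ℤ ↦ ∑ b ∈ Finset.Icc (-(k : ℤ)) k,
    (if |a| + |b| = (k : ℤ) then Real.cos (a * φ₁ + b * φ₂) else 0))]
  have h0 : ∑ b ∈ Finset.Icc (-(k : ℤ)) k, (if |(0 : ℤ)| + |b| = (k : ℤ) then Real.cos ((0 : ℤ) * φ₁ + b * φ₂) else 0) =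
      if 0 = k then Real.cos ((0 : ℤ) * φ₁ + (0 : ℤ) * φ₂) else
        Real.cos ((0 : ℤ) * φ₁ + ((k - 0 : ℕ) : ℤ) * φ₂) + Real.cos ((0 : ℤ) * φ₁ + (-((k - 0 : ℕ) : ℤ) : ℤ) * φ₂) :=
    sum_Icc_ite_abs_eq (fun b : ℤ ↦ Real.cos ((0 : ℤ) * φ₁ + b * φ₂)) (by simp) (Nat.zero_le k)
  have hpos : ∀ i ∈ range k, ∑ b ∈ Finset.Icc (-(k : ℤ)) k,
      (if |((i + 1 : ℕ) : ℤ)| + |b| = (k : ℤ) then Real.cos ((((i + 1 : ℕ) : ℤ)) * φ₁ + b * φ₂) else 0) =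
      if i + 1 = k then Real.cos ((((i + 1 : ℕ) : ℤ)) * φ₁ + (0 : ℤ) * φ₂) else
        Real.cos ((((i + 1 : ℕ) : ℤ)) * φ₁ + ((k - (i + 1) : ℕ) : ℤ) * φ₂) +
          Real.cos ((((i + 1 : ℕ) : ℤ)) * φ₁ + (-((k - (i + 1) : ℕ) : ℤ) : ℤ) * φ₂) := fun i hi ↦
    sum_Icc_ite_abs_eq (fun b : ℤ ↦ Real.cos ((((i + 1 : ℕ) : ℤ)) * φ₁ + b * φ₂)) (by rw [Nat.abs_cast])
      (mem_range.mp hi)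
  have hneg : ∀ i ∈ range k, ∑ b ∈ Finset.Icc (-(k : ℤ)) k,
      (if |(-((i + 1 : ℕ) : ℤ))| + |b| = (k : ℤ) then Real.cos (((-((i + 1 : ℕ) : ℤ) : ℤ)) * φ₁ + b * φ₂) else 0) =
      if i + 1 = k then Real.cos (((-((i + 1 : ℕ) : ℤ) : ℤ)) * φ₁ + (0 : ℤ) * φ₂) else
        Real.cos (((-((i + 1 : ℕ) : ℤ) : ℤ)) * φ₁ + ((k - (i + 1) : ℕ) : ℤ) * φ₂) +
          Real.cos (((-((i + 1 : ℕ) : ℤ) : ℤ)) * φ₁ + (-((k - (i + 1) : ℕ) : ℤ) : ℤ) * φ₂) := fun i hi ↦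
    sum_Icc_ite_abs_eq (fun b : ℤ ↦ Real.cos (((-((i + 1 : ℕ) : ℤ) : ℤ)) * φ₁ + b * φ₂)) (by rw [abs_neg, Nat.abs_cast])
      (mem_range.mp hi)
  rw [h0, add_comm, Finset.sum_range_succ' _ k]
  congr 1
  · refine Finset.sum_congr rfl fun i hi ↦ ?_
    rw [hpos i hi, hneg i hi, if_neg (by omega : i + 1 ≠ 0)]
    by_cases h1 : i + 1 = k
    · rw [if_pos h1, if_pos h1, if_pos (by omega : k - (i + 1) = 0)]
      simp only [Int.cast_zero, zero_mul, add_zero, Int.cast_neg, Int.cast_natCast, neg_mul, Real.cos_neg]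
      ring
    · have hik : i < k := mem_range.mp hi
      rw [if_neg h1, if_neg h1, if_neg (by omega : k - (i + 1) ≠ 0)]
      simp only [Int.cast_neg, Int.cast_natCast, neg_mul, Real.cos_add, Real.cos_neg, Real.sin_neg]
      ring
  · rw [if_pos rfl, one_mul, Nat.sub_zero]
    by_cases hk : k = 0
    · rw [if_pos hk.symm, if_pos hk]
      simp
    · rw [if_neg (Ne.symm hk), if_neg hk]
      simp only [Int.cast_zero, zero_mul, zero_add, Int.cast_neg, Int.cast_natCast, neg_mul, Real.cos_neg]
      ring

/-! ### §2 `c_m(φ) = [X^m]((1 − X²)∑_kU_k(cos φ)X^k)` and `∑_{i+j=k}c_ic_j = [X^k]((1 − X²)∑_kχ̃_kX^k) = χ̃_k − χ̃_{k−2}` -/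

/-- `c_m(φ) := ∑_{|a| = m}cos(aφ)` (`= 1` for `m = 0`, `2cos(mφ)` for `m ≥ 1`) is the `X^m`-coefficient of `(1 − X²)∑_kU_k(cos φ)X^k`
(`U_k − U_{k−2} = 2T_k`, `T_m(cos φ) = cos(mφ)`). [folklore] -/
private theorem ite_eq_coeff_one_sub_X_sq_mul_mk_U (φ : ℝ) (m : ℕ) :
    (if m = 0 then (1 : ℝ) else 2 * Real.cos (m * φ)) =
      coeff m (((1 : ℝ⟦X⟧) - X ^ 2) * PowerSeries.mk (fun k : ℕ ↦ (U ℝ k).eval (Real.cos φ))) := by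
  rcases m with _ | m
  · rw [if_pos rfl, sub_mul, one_mul, map_sub, coeff_mk, coeff_X_pow_mul', if_neg (by omega)]
    simp
  · rw [if_neg (by omega), coeff_succ_one_sub_X_sq_mul_mk_U_eval, Polynomial.Chebyshev.T_real_cos]
    push_cast
    ring_nf

/-- `[X^k]((1 − X²)∑_jχ̃_jX^j) = χ̃_k − χ̃_{k−2}` (`χ̃_{−1} = χ̃_{−2} = 0`). [folklore] -/
private theorem coeff_one_sub_X_sq_mul_mk_threeSphereHarmonicCharacter (c₁ c₂ : ℝ) (k : ℕ) :
    coeff k (((1 : ℝ⟦X⟧) - X ^ 2) * PowerSeries.mk (fun j : ℕ ↦ threeSphereHarmonicCharacter j c₁ c₂)) =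
      threeSphereHarmonicCharacter k c₁ c₂ - if 2 ≤ k then threeSphereHarmonicCharacter (k - 2) c₁ c₂ else 0 := by
  rw [sub_mul, one_mul, map_sub, coeff_mk, coeff_X_pow_mul']
  split_ifs <;> simp [coeff_mk]

/-- **The one-norm character sum is a difference of harmonic characters**:
`∑_{(a,b) ∈ ℤ², |a|+|b| = k}cos(aφ₁ + bφ₂) = χ̃_k(cos φ₁, cos φ₂) − χ̃_{k−2}(cos φ₁, cos φ₂)` — the coefficient form of
`∑_{μ ∈ ℤ²}e^{i⟨μ,φ⟩}z^{‖μ‖₁} = ∏ᵢ(1 − z²)/((1 − e^{iφᵢ}z)(1 − e^{−iφᵢ}z)) = (1 − z²)·∑_kχ̃_k z^k`.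
[cite: LauretMiatelloRossetti2019, §3 (the computation before Theorem 3.1)] -/
theorem sum_oneNormSphere_cos_eq (φ₁ φ₂ : ℝ) (k : ℕ) :
    ∑ ab ∈ Finset.Icc (-(k : ℤ)) k ×ˢ Finset.Icc (-(k : ℤ)) k,
        (if |ab.1| + |ab.2| = (k : ℤ) then Real.cos (ab.1 * φ₁ + ab.2 * φ₂) else 0) =
      threeSphereHarmonicCharacter k (Real.cos φ₁) (Real.cos φ₂) -
        if 2 ≤ k then threeSphereHarmonicCharacter (k - 2) (Real.cos φ₁) (Real.cos φ₂) else 0 := by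
  rw [Finset.sum_product, sum_Icc_sum_Icc_ite_cos_eq, ← coeff_one_sub_X_sq_mul_mk_threeSphereHarmonicCharacter,
    mk_threeSphereHarmonicCharacter,
    show ((1 : ℝ⟦X⟧) - X ^ 2) * (((1 : ℝ⟦X⟧) - X ^ 2) * (PowerSeries.mk (fun j : ℕ ↦ (U ℝ j).eval (Real.cos φ₁)) *
      PowerSeries.mk (fun j : ℕ ↦ (U ℝ j).eval (Real.cos φ₂)))) =
      (((1 : ℝ⟦X⟧) - X ^ 2) * PowerSeries.mk (fun j : ℕ ↦ (U ℝ j).eval (Real.cos φ₁))) *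
        (((1 : ℝ⟦X⟧) - X ^ 2) * PowerSeries.mk (fun j : ℕ ↦ (U ℝ j).eval (Real.cos φ₂))) by ring,
    coeff_mul, Finset.Nat.sum_antidiagonal_eq_sum_range_succ_mk]
  refine Finset.sum_congr rfl fun i _ ↦ ?_
  rw [ite_eq_coeff_one_sub_X_sq_mul_mk_U, ite_eq_coeff_one_sub_X_sq_mul_mk_U]

/-! ### §3 Theorem 3.1 (n = 2): `N_𝓛(k) = dim E_{k(k+2)} − dim E_{(k−2)k}`, i.e. `F_L(z)(1 − z²) = Θ_𝓛(z)` -/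

/-- Orthogonality of characters of `ℤ/q`, indicator form: `[q ∣ M] = (1/q)∑_{l<q}cos(2πlM/q)`. [folklore] -/
private theorem ite_dvd_eq_sum_cos (q : ℕ) (hq : q ≠ 0) (M : ℤ) :
    (if (q : ℤ) ∣ M then (1 : ℝ) else 0) = 1 / q * ∑ l ∈ range q, Real.cos (2 * π * l * M / q) := by
  have hq0 : (q : ℝ) ≠ 0 := Nat.cast_ne_zero.mpr hq
  rw [sum_range_cos_two_pi_mul_div q hq M]
  split_ifs
  · field_simp
  · rw [mul_zero]

/-- **THEOREM 3.1 (Lauret–Miatello–Rossetti) for the three-dimensional lens spaces, coefficientwise.** "associate to a lens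
orbifold `L(q; s₁, …, s_n)` the congruence lattice `𝓛(q; s₁, …, s_n) := {(a₁, …, a_n) ∈ ℤⁿ : a₁s₁ + ⋯ + a_ns_n ≡ 0 (mod q)}` …
`N_𝓛(k) = #{μ = (a₁, …, a_n) ∈ 𝓛 : ‖μ‖₁ = |a₁| + ⋯ + |a_n| = k}` … `Θ_𝓛(z) := ∑_{k≥0}N_𝓛(k)z^k` … **Theorem 3.1.** If `L` is a lens
orbifold and `𝓛` its associated congruence lattice, then we have that `F_L(z) = Θ_𝓛(z)/(1 − z²)^{n−1}`" (`F_L(z) = ∑_k dim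
E_{k(k+2n−2)}z^k`, Ikeda–Yamamoto's generating function). Here `n = 2`: `N_𝓛(k)` — the number of `(a, b) ∈ ℤ²` with `|a| + |b| = k`
and `q ∣ ap₁ + bp₂` — satisfies `N_𝓛(k) + dim E_{(k−2)k} = dim E_{k(k+2)}` (`dim E_{(k−2)k} := 0` for `k < 2`), which is `Θ_𝓛(z) =
(1 − z²)F_L(z)` coefficientwise. Proof as printed: orthogonality of the characters of `ℤ/q` and the one-norm character sum
`sum_oneNormSphere_cos_eq`, then Ikeda–Yamamoto's (3.10). [cite: LauretMiatelloRossetti2019, Theorem 3.1 (n = 2)] -/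
theorem card_oneNormSphere_congruenceLattice_add (q : ℕ) (hq : q ≠ 0) (p₁ p₂ : ℤ) (k : ℕ) :
    ((Finset.Icc (-(k : ℤ)) k ×ˢ Finset.Icc (-(k : ℤ)) k).filter
        (fun ab : ℤ × ℤ ↦ |ab.1| + |ab.2| = (k : ℤ) ∧ (q : ℤ) ∣ ab.1 * p₁ + ab.2 * p₂)).card +
      (if 2 ≤ k then lensMultiplicity q p₁ p₂ (k - 2) else 0) = lensMultiplicity q p₁ p₂ k := by
  have hq0 : (q : ℝ) ≠ 0 := Nat.cast_ne_zero.mpr hq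
  -- the count as a character sum
  have hcount : (((Finset.Icc (-(k : ℤ)) k ×ˢ Finset.Icc (-(k : ℤ)) k).filter
      (fun ab : ℤ × ℤ ↦ |ab.1| + |ab.2| = (k : ℤ) ∧ (q : ℤ) ∣ ab.1 * p₁ + ab.2 * p₂)).card : ℝ) =
      1 / q * ∑ l ∈ range q, ∑ ab ∈ Finset.Icc (-(k : ℤ)) k ×ˢ Finset.Icc (-(k : ℤ)) k,
        (if |ab.1| + |ab.2| = (k : ℤ) then
          Real.cos (ab.1 * (2 * π * l * p₁ / q) + ab.2 * (2 * π * l * p₂ / q)) else 0) := by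
    rw [Finset.card_filter]
    push_cast
    rw [Finset.sum_comm, Finset.mul_sum]
    refine Finset.sum_congr rfl fun ab _ ↦ ?_
    by_cases hab : |ab.1| + |ab.2| = (k : ℤ)
    · simp only [hab, true_and, if_true]
      rw [ite_dvd_eq_sum_cos q hq]
      refine congrArg _ (Finset.sum_congr rfl fun l _ ↦ ?_)
      congr 1
      push_cast
      ring
    · simp only [hab, false_and, if_false, Finset.sum_const_zero, mul_zero]
  -- each character sum is `χ̃_k − χ̃_{k−2}`; then (3.10)
  have hreal : (((Finset.Icc (-(k : ℤ)) k ×ˢ Finset.Icc (-(k : ℤ)) k).filter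
      (fun ab : ℤ × ℤ ↦ |ab.1| + |ab.2| = (k : ℤ) ∧ (q : ℤ) ∣ ab.1 * p₁ + ab.2 * p₂)).card : ℝ) +
      (if 2 ≤ k then (lensMultiplicity q p₁ p₂ (k - 2) : ℝ) else 0) = lensMultiplicity q p₁ p₂ k := by
    rw [hcount, Finset.sum_congr rfl fun l _ ↦ sum_oneNormSphere_cos_eq _ _ k, Finset.sum_sub_distrib, mul_sub,
      ← lensMultiplicity_eq_sum_threeSphereHarmonicCharacter q hq p₁ p₂ k]
    split_ifs with hk
    · rw [← lensMultiplicity_eq_sum_threeSphereHarmonicCharacter q hq p₁ p₂ (k - 2)]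
      ring
    · rw [Finset.sum_const_zero, mul_zero, sub_zero, add_zero]
  exact_mod_cast hreal

/-- **Theorem 3.1, cumulative form**: `dim E_{k(k+2)}(L(q;p₁,p₂)) = ∑_{r ≤ k/2}N_𝓛(k − 2r)` (`F_L = Θ_𝓛/(1 − z²) = Θ_𝓛·∑_r z^{2r}`).
[cite: LauretMiatelloRossetti2019, Theorem 3.1 (n = 2)] -/
theorem lensMultiplicity_eq_sum_card_oneNormSphere_congruenceLattice (q : ℕ) (hq : q ≠ 0) (p₁ p₂ : ℤ) (k : ℕ) :
    lensMultiplicity q p₁ p₂ k = ∑ r ∈ range (k / 2 + 1),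
      ((Finset.Icc (-((k - 2 * r : ℕ) : ℤ)) ((k - 2 * r : ℕ) : ℤ) ×ˢ Finset.Icc (-((k - 2 * r : ℕ) : ℤ)) ((k - 2 * r : ℕ) : ℤ)).filter
        (fun ab : ℤ × ℤ ↦ |ab.1| + |ab.2| = ((k - 2 * r : ℕ) : ℤ) ∧ (q : ℤ) ∣ ab.1 * p₁ + ab.2 * p₂)).card := by
  induction k using Nat.strong_induction_on with
  | _ k ih =>
    rw [← card_oneNormSphere_congruenceLattice_add q hq p₁ p₂ k, Finset.sum_range_succ', Nat.mul_zero, Nat.sub_zero]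
    split_ifs with hk
    · rw [ih (k - 2) (by omega), show k / 2 = (k - 2) / 2 + 1 by omega]
      simp_rw [show ∀ r : ℕ, k - 2 * (r + 1) = k - 2 - 2 * r from fun r ↦ by omega]
      exact add_comm _ _
    · rw [show k / 2 = 0 by omega, Finset.sum_range_zero, zero_add, add_zero]

/-- **Theorem 3.1 in `ℝ⟦z⟧`**: `(1 − z²)·F_L(z) = Θ_𝓛(z)` for `L = L(q; p₁, p₂)`, `F_L(z) = ∑_k dim E_{k(k+2)}z^k`,
`Θ_𝓛(z) = ∑_k N_𝓛(k)z^k`. [cite: LauretMiatelloRossetti2019, Theorem 3.1 (n = 2)] -/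
theorem one_sub_X_sq_mul_mk_lensMultiplicity (q : ℕ) (hq : q ≠ 0) (p₁ p₂ : ℤ) :
    ((1 : ℝ⟦X⟧) - X ^ 2) * PowerSeries.mk (fun k : ℕ ↦ (lensMultiplicity q p₁ p₂ k : ℝ)) =
      PowerSeries.mk (fun k : ℕ ↦ (((Finset.Icc (-(k : ℤ)) k ×ˢ Finset.Icc (-(k : ℤ)) k).filter
        (fun ab : ℤ × ℤ ↦ |ab.1| + |ab.2| = (k : ℤ) ∧ (q : ℤ) ∣ ab.1 * p₁ + ab.2 * p₂)).card : ℝ)) := by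
  ext k
  rw [sub_mul, one_mul, map_sub, coeff_X_pow_mul']
  simp only [coeff_mk]
  rw [← card_oneNormSphere_congruenceLattice_add q hq p₁ p₂ k]
  split_ifs with hk
  · push_cast
    ring
  · push_cast
    ring

/-- **THEOREM 3.2 (Lauret–Miatello–Rossetti) for the three-dimensional lens spaces**: "`L` and `L'` are isospectral if and only
if `𝓛` and `𝓛'` are `‖·‖₁`-isospectral (i.e. `Θ_𝓛(z) = Θ_𝓛'(z)`)" — `L(q;p₁,p₂)` and `L(q';p₁',p₂')` have the same multiplicities
`dim E_{k(k+2)}` for all `k` iff their congruence lattices have the same one-norm counts `N_𝓛(k)` for all `k`.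
[cite: LauretMiatelloRossetti2019, Theorem 3.2 (n = 2)] -/
theorem lensMultiplicity_eq_iff_card_oneNormSphere_congruenceLattice_eq (q q' : ℕ) (hq : q ≠ 0) (hq' : q' ≠ 0)
    (p₁ p₂ p₁' p₂' : ℤ) :
    (∀ k : ℕ, lensMultiplicity q p₁ p₂ k = lensMultiplicity q' p₁' p₂' k) ↔
      ∀ k : ℕ, ((Finset.Icc (-(k : ℤ)) k ×ˢ Finset.Icc (-(k : ℤ)) k).filter
          (fun ab : ℤ × ℤ ↦ |ab.1| + |ab.2| = (k : ℤ) ∧ (q : ℤ) ∣ ab.1 * p₁ + ab.2 * p₂)).card =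
        ((Finset.Icc (-(k : ℤ)) k ×ˢ Finset.Icc (-(k : ℤ)) k).filter
          (fun ab : ℤ × ℤ ↦ |ab.1| + |ab.2| = (k : ℤ) ∧ (q' : ℤ) ∣ ab.1 * p₁' + ab.2 * p₂')).card := by
  constructor
  · intro h k
    have h1 := card_oneNormSphere_congruenceLattice_add q hq p₁ p₂ k
    have h2 := card_oneNormSphere_congruenceLattice_add q' hq' p₁' p₂' k
    rw [h k] at h1
    split_ifs at h1 h2 with hk
    · rw [h (k - 2)] at h1
      omega
    · omega
  · intro h k
    rw [lensMultiplicity_eq_sum_card_oneNormSphere_congruenceLattice q hq p₁ p₂ k,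
      lensMultiplicity_eq_sum_card_oneNormSphere_congruenceLattice q' hq' p₁' p₂' k]
    exact Finset.sum_congr rfl fun r _ ↦ h (k - 2 * r)

/-- `N_𝓛(0) = 1` (the origin). [cite: LauretMiatelloRossetti2019, §3] -/
theorem card_oneNormSphere_congruenceLattice_zero (q : ℕ) (hq : q ≠ 0) (p₁ p₂ : ℤ) :
    ((Finset.Icc (-((0 : ℕ) : ℤ)) ((0 : ℕ) : ℤ) ×ˢ Finset.Icc (-((0 : ℕ) : ℤ)) ((0 : ℕ) : ℤ)).filter
        (fun ab : ℤ × ℤ ↦ |ab.1| + |ab.2| = ((0 : ℕ) : ℤ) ∧ (q : ℤ) ∣ ab.1 * p₁ + ab.2 * p₂)).card = 1 := by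
  have h := card_oneNormSphere_congruenceLattice_add q hq p₁ p₂ 0
  rwa [if_neg (by omega), add_zero, lensMultiplicity_zero_right] at h

/-- `N_𝓛(1) = 0` for a lens SPACE (`p₁, p₂ ≢ 0 (mod q)`: `±e₁, ±e₂ ∉ 𝓛`), matching `dim E₃ = 0`. [cite: LauretMiatelloRossetti2019, §3] -/
theorem card_oneNormSphere_congruenceLattice_one {q : ℕ} (hq : q ≠ 0) {p₁ p₂ : ℤ} (h₁ : ¬(q : ℤ) ∣ p₁)
    (h₂ : ¬(q : ℤ) ∣ p₂) :
    ((Finset.Icc (-((1 : ℕ) : ℤ)) ((1 : ℕ) : ℤ) ×ˢ Finset.Icc (-((1 : ℕ) : ℤ)) ((1 : ℕ) : ℤ)).filter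
        (fun ab : ℤ × ℤ ↦ |ab.1| + |ab.2| = ((1 : ℕ) : ℤ) ∧ (q : ℤ) ∣ ab.1 * p₁ + ab.2 * p₂)).card = 0 := by
  have h := card_oneNormSphere_congruenceLattice_add q hq p₁ p₂ 1
  rwa [if_neg (by omega), add_zero, lensMultiplicity_one_right h₁ h₂] at h

/-- **Sanity check `q = 1` (`𝓛 = ℤ²`, `L = S³`)**: the one-norm sphere of radius `k` in `ℤ²` has `4k` points (`1` for `k = 0`),
i.e. Theorem 3.1 for `q = 1`: `N_{ℤ²}(k) = dim E_{k(k+2)}(S³) − dim E_{(k−2)k}(S³) = (k+1)² − (k−1)² = 4k`.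
[cite: LauretMiatelloRossetti2019, Theorem 3.1 (the case `q = 1`: `𝓛 = ℤ²`, `L = S³`)] -/
theorem card_oneNormSphere_int_sq (k : ℕ) :
    ((Finset.Icc (-(k : ℤ)) k ×ˢ Finset.Icc (-(k : ℤ)) k).filter
        (fun ab : ℤ × ℤ ↦ |ab.1| + |ab.2| = (k : ℤ) ∧ ((1 : ℕ) : ℤ) ∣ ab.1 * 1 + ab.2 * 1)).card =
      if k = 0 then 1 else 4 * k := by
  have h := card_oneNormSphere_congruenceLattice_add 1 one_ne_zero 1 1 k
  rw [lensMultiplicity_one_left, lensMultiplicity_one_left] at h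
  by_cases hk : k = 0
  · subst hk
    rw [if_pos rfl]
    simpa using h
  · rw [if_neg hk]
    by_cases h2 : 2 ≤ k
    · rw [if_pos h2] at h
      obtain ⟨j, rfl⟩ : ∃ j, k = j + 2 := ⟨k - 2, by omega⟩
      rw [Nat.add_sub_cancel, show (j + 2 + 1) ^ 2 = (j + 1) ^ 2 + 4 * (j + 2) by ring] at h
      omega
    · rw [if_neg h2, add_zero] at h
      obtain rfl : k = 1 := by omega
      simpa using h

end Literature.Analysis.InnerProduct
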